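import Mathlib
import HarnessLib
import Summits.NavierStokesRegularity.NavierStokesRegularity.Theorems.PoloidalWindowDoorLrcModEntireCurvedWebPackage
import Summits.NavierStokesRegularity.NavierStokesRegularity.Theorems.PoloidalWindowDoorLrcModEntireCurvedSheetTransport
import Summits.NavierStokesRegularity.NavierStokesRegularity.Theorems.PoloidalWindowDoorPoloidalWindowRigidityVerticalShearGerm

/-!
# Route `PoloidalWindowDoor`, item `LrcModEntire` (stmt-NavierStokesRegularity-20428) — CELL (Q4-SONIC), SUB-CELL «CURVED BRANCH» IS EMPTY (core form)

Cell ns-regularity-ideate, stub-worker seat ns-poloidal-K2-p2 g16 under the LEAD of item 20428 (ns-poloidal-K2-p3 g16);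
`--supports stmt-NavierStokesRegularity-20428 --as helper`.  Memos `Cruxes/LrcModEntire/T2B-g16.md` §5, `T2B-g16-sonic.md` v2 §3/§5.  The ¬line twin of LEAD g16's
`…Q4SonicLineFlat.q4sonic_line_flat_core` (p732257) — and MORE: over a CURVED branch the transported quantity carries the curvature `k(s)`, so BOTH slope sub-cases die:

In the SONIC cell (`R(0,·)` affine on `(−δ,δ)`) the curved parallel-web package (`…CurvedWebPackage.curved_web_package`: web offset `d`, curvature `κf > 0`, Huygens
`κf d′² = R″ − μκf`, Fermi factor `|k d| ≤ 1/2`) makes the web sheet CHARACTERISTIC (`d′² + μ(−1,·) = 0`), the web-point Hessian in the moving frame is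
`B[Γ′,Γ′] = 0`, `B[JΓ′,JΓ′] = −σκf(z)` (so `a₂ = D²U₂(W)[JΓ′,JΓ′]` does NOT depend on `s`), and the CURVED TRANSPORT LAW
(`…CurvedSheetTransport.curved_transport_on_characteristic_sheet`) makes `(1 − k(s)d(z))·d′(z)·κf(z)²` constant in `z`, equal to `d′(0)κf(0)²` for EVERY `s`:
* `μ(−1,0) = 0` ⇒ `d′(0) = 0` ⇒ `d′ ≡ 0` ⇒ `μ(−1,·) ≡ 0` on the window ⇒ no vertical shear on an open slab ⇒ `U ≡ 0`
  (`…VerticalShearGerm.eq_zero_of_verticalShear_eq_zero_on_open`) — as in the straight case;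
* `μ(−1,0) ≠ 0` ⇒ `d′(0) ≠ 0` ⇒ at a height `z₁` with `d(z₁)d′(z₁) ≠ 0`: `k(s) = k(0)` for all `s` — CONSTANT CURVATURE ⇒ the proper limit branch is a LINE
  (`…PlanarCurveRigidity.isLine_of_curvature_const_of_tendsto` + `…Q4LimitBranchProper.limitBranch_injective_proper`) — against the cell literal `¬ line`.

* `q4sonic_curved_core` — hypotheses = those of `curved_web_package` + Peakless for `U` + «sonic» + «¬ line» ⊢ `False`.

The verbatim-stub wrapper (`stub_Q4sonicCurved` of twist_split v11) is the next file.
WHAT THIS IS NOT: not a claim about Navier–Stokes regularity — one research sub-cell of the (TH) column of line twist_split closes; (Q4-curved), (Q4-sonic, line,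
μ(−1,0) < 0), T2b-flat, C2a′, C2b′, the wall ⟨27893⟩ and items 20428 / 19708 stay OPEN (bears_on LADDER-NS N0).
-/

noncomputable section

-- the summit and its single sub-problem share the name (CONVENTIONS §1), as in every Theorems file
set_option linter.dupNamespace false

namespace Summit.NavierStokesRegularity.NavierStokesRegularity.Theorems.PoloidalWindowDoorLrcModEntireQ4SonicCurved

open Set Function Filter Topology Metric
open scoped RealInnerProductSpace InnerProductSpace ContDiff
open Literature.Analysis Literature.Analysis.FluidPDE Literature.Analysis.UnboundedOperators
open Summit.NavierStokesRegularity.NavierStokesRegularity.Theorems.PoloidalWindowDoorLrcModEntireSheetFlattenTools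
open Summit.NavierStokesRegularity.NavierStokesRegularity.Theorems.PoloidalWindowDoorLrcModEntireQ4LineTools
open Summit.NavierStokesRegularity.NavierStokesRegularity.Theorems.PoloidalWindowDoorLrcModEntireParallelWebsIdentity
open Summit.NavierStokesRegularity.NavierStokesRegularity.Theorems.PoloidalWindowDoorPoloidalWindowRigidityTimeHeightShearLinearSlice
open Summit.NavierStokesRegularity.NavierStokesRegularity.Theorems.PoloidalWindowDoorPoloidalWindowRigidityConstantShearSlice
open Summit.NavierStokesRegularity.NavierStokesRegularity.Theorems.PoloidalWindowDoorPoloidalWindowRigidityVerticalShearGerm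
open Summit.NavierStokesRegularity.NavierStokesRegularity.Theorems.LocalSineTubeDoorProfileAlignedWindowRigidityAncient
open Summit.NavierStokesRegularity.NavierStokesRegularity.Theorems.PoloidalWindowDoorLrcModEntireRidgeGlobalBranchODE
open Summit.NavierStokesRegularity.NavierStokesRegularity.Theorems.PoloidalWindowDoorLrcModEntireRidgeGlobalBranchFrame
open Summit.NavierStokesRegularity.NavierStokesRegularity.Theorems.PoloidalWindowDoorLrcModEntirePlanarCurveRigidity
open Summit.NavierStokesRegularity.NavierStokesRegularity.Theorems.PoloidalWindowDoorLrcModEntireQ4LimitBranchProper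
open Summit.NavierStokesRegularity.NavierStokesRegularity.Theorems.PoloidalWindowDoorLrcModEntireCurvedWebHuygens
open Summit.NavierStokesRegularity.NavierStokesRegularity.Theorems.PoloidalWindowDoorLrcModEntireCurvedWebPackage
open Summit.NavierStokesRegularity.NavierStokesRegularity.Theorems.PoloidalWindowDoorLrcModEntireCurvedSheetTransport

/-- **CELL (Q4-SONIC), SUB-CELL «CURVED BRANCH» IS EMPTY — core form.**  See the module docstring. -/
theorem q4sonic_curved_core {C : ℝ} {U : ℝ → EuclideanSpace ℝ (Fin 3) → EuclideanSpace ℝ (Fin 3)} {Γ νΓ : ℝ → EuclideanSpace ℝ (Fin 3)} {R μ : ℝ → ℝ → ℝ}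
    {σ κ r δ ρ : ℝ}
    (hUrate : HasTypeITimeDecay C U) (hUcont : ContinuousOn (uncurry U) (Iio (0 : ℝ) ×ˢ univ))
    (hUmild : ∀ s t : ℝ, s < t → t < 0 → ∀ x, U t x = heatExtension (U s) (t - s) x - oseenDuhamel 1 s U U t x)
    (hUdiv : ∀ t < 0, VectorCalculus.IsDivFree (U t))
    (hUpol : ∀ s < 0, ∀ q, ⟪curl (U s) q, EuclideanSpace.single 2 1⟫_ℝ = 0)
    (hUne : U (-1) 0 2 ≠ 0) (hUhotbd : ∀ t < 0, ∀ x, Real.sqrt (-t) * |U t x 2| ≤ |U (-1) 0 2|)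
    (hUpeak : ∀ (s z₀ σ M : ℝ) (K O : Set (EuclideanSpace ℝ (Fin 3))), s < 0 →
      ((σ = 1 ∨ σ = -1) ∧ IsCompact K ∧ K.Nonempty ∧ (∀ q ∈ K, q 2 = z₀ ∧ σ * U s q 2 = M) ∧
        IsOpen O ∧ K ⊆ O ∧ (∀ q ∈ O, q 2 = z₀ → σ * U s q 2 ≤ M) ∧
        (∀ q ∈ O, q 2 = z₀ → σ * U s q 2 = M → q ∈ K)) → False)
    (hUcrit : ∀ y ∈ {y : EuclideanSpace ℝ (Fin 3) | y 2 = 0 ∧ U (-1) y 2 = U (-1) 0 2}, fderiv ℝ (fun x => U (-1) x 2) y = 0)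
    (hσ : σ = 1 ∨ σ = -1) (hσN : σ * U (-1) 0 2 = |U (-1) 0 2|) (hκ : 0 < κ)
    (hΓ : ContDiff ℝ ∞ Γ) (hΓ0 : Γ 0 = 0) (hΓ2 : ∀ s, Γ s 2 = 0) (hΓunit : ∀ s, ‖deriv Γ s‖ = 1) (hΓhot : ∀ s, U (-1) (Γ s) 2 = U (-1) 0 2)
    (hν : ∀ s, νΓ s = WithLp.toLp 2 ![-(deriv Γ s 1), deriv Γ s 0, 0])
    (hΓcurv : ∀ s, κ ≤ -(fderiv ℝ (fderiv ℝ (fun y => σ * U (-1) y 2)) (Γ s) (νΓ s) (νΓ s)))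
    (hr : 0 < r) (hδ : 0 < δ)
    (hconc : ∀ τ z : ℝ, |τ| < δ → |z| < δ → ∀ s : ℝ, ∀ n ∈ Ioo (-r) r,
      fderiv ℝ (fderiv ℝ (fun y => σ * U (-1 + τ) y 2)) (Γ s + n • νΓ s + z • EuclideanSpace.single 2 (1 : ℝ)) (νΓ s) (νΓ s) < 0)
    (hweb : ∀ τ₀ z₀ : ℝ, |τ₀| < δ → |z₀| < δ → ∀ s₀ : ℝ, ∃ n₀ ∈ Ioo (-r) r,
      σ * U (-1 + τ₀) (Γ s₀ + n₀ • νΓ s₀ + z₀ • EuclideanSpace.single 2 (1 : ℝ)) 2 = R τ₀ z₀ ∧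
      (∀ n ∈ Icc (-r) r, n ≠ n₀ → σ * U (-1 + τ₀) (Γ s₀ + n • νΓ s₀ + z₀ • EuclideanSpace.single 2 (1 : ℝ)) 2 < R τ₀ z₀) ∧
      DifferentiableAt ℝ (uncurry R) (τ₀, z₀) ∧
      fderiv ℝ (uncurry fun τ y => σ * U (-1 + τ) y 2) (τ₀, Γ s₀ + n₀ • νΓ s₀ + z₀ • EuclideanSpace.single 2 (1 : ℝ)) =
        (fderiv ℝ (uncurry R) (τ₀, z₀)).comp
          ((ContinuousLinearMap.fst ℝ ℝ (EuclideanSpace ℝ (Fin 3))).prod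
            ((EuclideanSpace.proj (2 : Fin 3)).comp (ContinuousLinearMap.snd ℝ ℝ (EuclideanSpace ℝ (Fin 3))))))
    (hρ : 0 < ρ) (hμ3 : ContDiff ℝ 3 (uncurry μ))
    (hslabU : ∀ t : ℝ, |t + 1| < ρ → ∀ x : EuclideanSpace ℝ (Fin 3), |x 2| < ρ → ∀ b : Fin 3, b ≠ 2 →
      fderiv ℝ (U t) x (EuclideanSpace.single 2 1) b = μ t (x 2) * fderiv ℝ (U t) x (EuclideanSpace.single b 1) 2)
    (hevU : ∀ t₀ : ℝ, |t₀ + 1| < ρ → ∀ y₀ : EuclideanSpace ℝ (Fin 3), y₀ 2 = 0 →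
      ∀ᶠ z in 𝓝 ((t₀, y₀) : ℝ × EuclideanSpace ℝ (Fin 3)), ∀ b : Fin 3, b ≠ 2 →
        fderiv ℝ (U z.1) z.2 (EuclideanSpace.single 2 1) b = μ z.1 (z.2 2) * fderiv ℝ (U z.1) z.2 (EuclideanSpace.single b 1) 2)
    (hson : ∃ a b : ℝ, ∀ z : ℝ, |z| < δ → R 0 z = a + b * z) (hcurved : ¬ (∀ s : ℝ, Γ s = s • deriv Γ 0)) : False := by
  have hm1 : (-1 : ℝ) < 0 := by norm_num
  /- STEP A: the curved parallel-web package. -/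
  obtain ⟨δ₂, d, κf, k, K, hδ₂, hδ₂δ, hδ₂ρ, hk, hkd, -, hd0, hdi, hdJ, hRi, hκfd, -, hwin, hHuy, -, hcrit, hconcW, hridgeW, -⟩ :=
    curved_web_package hUrate hUcont hUmild hUdiv hUpol hUne hUhotbd hUcrit hσ hσN hκ hΓ hΓ2 hΓunit hΓhot hν hΓcurv hr hδ hconc hweb hρ hμ3
      hslabU hevU
  have h0mem : (0 : ℝ) ∈ Ioo (-δ₂) δ₂ := ⟨by linarith, hδ₂⟩
  have hwinδ : ∀ z ∈ Ioo (-δ₂) δ₂, |z| < δ := fun z hz => (hwin z hz).1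
  have hwinρ : ∀ z ∈ Ioo (-δ₂) δ₂, |z| < ρ := fun z hz => (hwin z hz).2.1
  have hκfpos : ∀ z ∈ Ioo (-δ₂) δ₂, 0 < κf z := fun z hz => (hwin z hz).2.2.1
  /- STEP B: sonic ⇒ `R″(0,·) = 0` on the window ⇒ the sheet is characteristic, `d′² + μ ≡ 0`. -/
  obtain ⟨a, b, hab⟩ := hson
  have hR'' : ∀ z ∈ Ioo (-δ₂) δ₂, deriv (deriv (R 0)) z = 0 := by
    intro z hz
    have hev : R 0 =ᶠ[𝓝 z] fun z' => a + b * z' := by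
      filter_upwards [(isOpen_lt continuous_abs continuous_const).mem_nhds ((hwinδ z hz) : z ∈ {z' : ℝ | |z'| < δ})]
        with z' hz' using hab z' hz'
    have hev1 : deriv (R 0) =ᶠ[𝓝 z] fun _ => b := by
      filter_upwards [hev.eventuallyEq_nhds] with z' hz'
      have hd : HasDerivAt (fun z'' : ℝ => a + b * z'') b z' := by
        simpa using ((hasDerivAt_id z').const_mul b).const_add a
      rw [hz'.deriv_eq, hd.deriv]
    rw [hev1.deriv_eq, deriv_const]
  have hQ0 : ∀ z ∈ Ioo (-δ₂) δ₂, deriv d z ^ 2 + μ (-1) z = 0 := by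
    intro z hz
    have h := hHuy z hz
    rw [hR'' z hz] at h
    have h2 : κf z * (deriv d z ^ 2 + μ (-1) z) = 0 := by linear_combination h
    rcases mul_eq_zero.1 h2 with h3 | h3
    · exact absurd h3 (hκfpos z hz).ne'
    · exact h3
  /- STEP C: the slice `θ = U₂(−1,·)`, the slice law on the slab, the Fermi factor. -/
  have hUan : AnalyticOnNhd ℝ (U (-1)) univ := analyticOnNhd_slice hUcont (bdd_of_hasTypeITimeDecay hUrate) hUmild hm1
  have hU2 : ContDiff ℝ 2 (U (-1)) := hUan.contDiff
  have hUd : Differentiable ℝ (U (-1)) := hU2.differentiable (by norm_num)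
  have hθan : AnalyticOnNhd ℝ (fun y => U (-1) y 2) univ := fun x _ =>
    ((EuclideanSpace.proj (𝕜 := ℝ) (2 : Fin 3)).analyticAt _).comp (hUan x (mem_univ _))
  have hθ : ContDiff ℝ ∞ (fun y => U (-1) y 2) := hθan.contDiff
  have hθ2 : ContDiff ℝ 2 (fun y => U (-1) y 2) := hθan.contDiff
  have hF₀2 : ContDiff ℝ 2 (fun y => σ * U (-1) y 2) := contDiff_const.mul hθ2
  have hμfun : μ (-1) = uncurry μ ∘ fun z : ℝ => ((-1 : ℝ), z) := by funext z; rfl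
  have hμd : ∀ z ∈ Ioo (-δ₂) δ₂, DifferentiableAt ℝ (μ (-1)) z := fun z _ => by
    rw [hμfun]; exact ((hμ3.differentiable (by norm_num)) _).comp z ((differentiableAt_const _).prodMk differentiableAt_id)
  have hdI : ContDiffOn ℝ ∞ d (Ioo (-δ₂) δ₂) := fun z hz => (hdi z (hwinδ z hz)).contDiffWithinAt
  have hplane : ∀ z : ℝ, |z| < ρ → ∀ y : EuclideanSpace ℝ (Fin 3), y 2 = z → ∀ b : Fin 3, b ≠ 2 →
      fderiv ℝ (U (-1)) y (EuclideanSpace.single 2 (1 : ℝ)) b = μ (-1) z * fderiv ℝ (U (-1)) y (EuclideanSpace.single b (1 : ℝ)) 2 := by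
    intro z hz y hy b hb
    have h := hslabU (-1) (by simp [hρ]) y (by rw [hy]; exact hz) b hb
    rw [hy] at h; exact h
  have hlawI : ∀ x : EuclideanSpace ℝ (Fin 3), x 2 ∈ Ioo (-δ₂) δ₂ →
      fderiv ℝ (fun y => fderiv ℝ (fun y' => U (-1) y' 2) y (EuclideanSpace.single 2 (1 : ℝ))) x (EuclideanSpace.single 2 (1 : ℝ)) =
        -μ (-1) (x 2) * (fderiv ℝ (fun y => fderiv ℝ (fun y' => U (-1) y' 2) y (EuclideanSpace.single 0 (1 : ℝ))) x
            (EuclideanSpace.single 0 (1 : ℝ)) +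
          fderiv ℝ (fun y => fderiv ℝ (fun y' => U (-1) y' 2) y (EuclideanSpace.single 1 (1 : ℝ))) x
            (EuclideanSpace.single 1 (1 : ℝ))) := fun x hx =>
    plane_wave_identity hU2 (fun y => div_coord (hUdiv (-1) hm1) y) (hplane (x 2) (hwinρ _ hx)) rfl
  have hΓc2 : ContDiff ℝ 2 Γ := hΓ.of_le (by norm_cast)
  have hT2 : ∀ s, deriv Γ s 2 = 0 := fun s => (deriv_horizontal hΓc2 hΓ2 s).1
  have hν2 : ∀ s, rotJ (deriv Γ s) 2 = 0 := fun s => (rotJ_facts (hT2 s) (hΓunit s)).1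
  have hJ : ∀ s : ℝ, ∀ z ∈ Ioo (-δ₂) δ₂, 1 - k s * d z ≠ 0 := by
    intro s z hz h0
    have h := (hdJ z hz).2 s
    have : k s * d z = 1 := by linarith
    rw [this] at h; norm_num at h
  have hνW : ∀ s : ℝ, ∀ z ∈ Ioo (-δ₂) δ₂, fderiv ℝ (fun y => U (-1) y 2) (Γ s + d z • rotJ (deriv Γ s) + z • e2) (rotJ (deriv Γ s)) = 0 :=
    fun s z hz => hcrit s z hz _ (hν2 s)
  have hTW : ∀ s : ℝ, ∀ z ∈ Ioo (-δ₂) δ₂, fderiv ℝ (fun y => U (-1) y 2) (Γ s + d z • rotJ (deriv Γ s) + z • e2) (deriv Γ s) = 0 :=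
    fun s z hz => hcrit s z hz _ (hT2 s)
  /- STEP D: the web-point Hessian of `θ` in the moving frame: `B[Γ′,Γ′] = 0`, `B[JΓ′,JΓ′] = −σκf(z)` (independent of `s`). -/
  have hD2σ : ∀ x u w, fderiv ℝ (fderiv ℝ (fun y => σ * U (-1) y 2)) x u w = σ * fderiv ℝ (fderiv ℝ (fun y => U (-1) y 2)) x u w := by
    intro x u w
    rw [← nested_eq_fderiv_fderiv hF₀2, ← nested_eq_fderiv_fderiv hθ2, nested_const_mul hθ2]
  have hσσ : σ * σ = 1 := by rcases hσ with h | h <;> simp [h]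
  -- `B[T,T] = 0`: the `s`-derivative of `∂_TU₂(W) ≡ 0` (turning term killed by `∂_νU₂(W) = 0`)
  have hBTT : ∀ s : ℝ, ∀ z ∈ Ioo (-δ₂) δ₂,
      fderiv ℝ (fderiv ℝ (fun y => U (-1) y 2)) (Γ s + d z • rotJ (deriv Γ s) + z • e2) (deriv Γ s) (deriv Γ s) = 0 := by
    intro s z hz
    set Gd : ℝ × ℝ → ℝ := fun q => d q.2 with hGd
    have hdd : DifferentiableAt ℝ d z := (hdi z (hwinδ z hz)).differentiableAt (by simp)
    have hGdd : DifferentiableAt ℝ Gd (s, z) := hdd.comp (s, z) differentiableAt_snd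
    have hGd_fd : fderiv ℝ Gd (s, z) (1, 0) = 0 := by
      rw [hGd, show (fun q : ℝ × ℝ => d q.2) = d ∘ Prod.snd from rfl, fderiv_comp (s, z) hdd differentiableAt_snd]
      simp [fderiv_snd]
    have hTWr : ∀ q ∈ region (Ioo (-δ₂) δ₂), fderiv ℝ (fun y => U (-1) y 2) (Γ q.1 + Gd q • rotJ (deriv Γ q.1) + q.2 • e2) (deriv Γ q.1) = 0 :=
      fun q hq => hTW q.1 q.2 hq
    have hTd : HasDerivAt (deriv Γ) (k s • rotJ (deriv Γ s)) s := by
      have h := (hasDerivAt_of_contDiff_two hΓc2 s).2; rwa [hk s] at h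
    have hp : ((s, z) : ℝ × ℝ) ∈ region (Ioo (-δ₂) δ₂) := hz
    have h := fderiv_eq_zero_of_eqOn_region isOpen_Ioo hTWr hp (1, 0)
    rw [fderiv_moving_deriv hΓc2 hΓ2 hk hGdd hθ2 hTd, hGd_fd] at h
    have hν0 := hνW s z hz
    simp only [map_smul, _root_.smul_apply, smul_eq_mul, zero_smul, add_zero, one_mul] at h
    simp only [hGd] at h
    have hkey : (1 - k s * d z) * fderiv ℝ (fderiv ℝ (fun y => U (-1) y 2)) (Γ s + d z • rotJ (deriv Γ s) + z • e2) (deriv Γ s) (deriv Γ s) = 0 := by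
      linear_combination h - k s * hν0
    rcases mul_eq_zero.1 hkey with h1 | h1
    · exact absurd h1 (hJ s z hz)
    · exact h1
  have ha₂ : ∀ s : ℝ, ∀ z ∈ Ioo (-δ₂) δ₂,
      fderiv ℝ (fderiv ℝ (fun y => U (-1) y 2)) (Γ s + d z • rotJ (deriv Γ s) + z • e2) (rotJ (deriv Γ s)) (rotJ (deriv Γ s)) = -σ * κf z := by
    intro s z hz
    have h := hridgeW s z hz
    rw [hD2σ, hD2σ, hBTT s z hz, mul_zero, zero_add] at h
    have : σ * (σ * fderiv ℝ (fderiv ℝ (fun y => U (-1) y 2)) (Γ s + d z • rotJ (deriv Γ s) + z • e2) (rotJ (deriv Γ s)) (rotJ (deriv Γ s))) =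
        σ * -κf z := by rw [h]
    rw [← mul_assoc, hσσ, one_mul] at this
    linear_combination this
  /- STEP E: the transport law ⇒ `(1 − k(s)d(z))·d′(z)·κf(z)² = d′(0)·κf(0)²` for every `s` and `z` in the window. -/
  have hconst : ∀ s : ℝ, ∀ z ∈ Ioo (-δ₂) δ₂, (1 - k s * d z) * deriv d z * κf z ^ 2 = deriv d 0 * κf 0 ^ 2 := by
    intro s z hz
    have htr : ∀ z' ∈ Ioo (-δ₂) δ₂, HasDerivAt (fun z'' : ℝ => (1 - k s * d z'') * deriv d z'' *
        (fderiv ℝ (fderiv ℝ (fun y => U (-1) y 2)) (Γ s + d z'' • rotJ (deriv Γ s) + z'' • e2) (rotJ (deriv Γ s)) (rotJ (deriv Γ s))) ^ 2) 0 z' :=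
      fun z' hz' => curved_transport_on_characteristic_sheet hθ isOpen_Ioo hμd hdI hΓc2 hΓ2 hΓunit hk hJ hlawI hνW hTW hQ0 s hz'
    have h := isOpen_Ioo.is_const_of_deriv_eq_zero isPreconnected_Ioo (fun w hw => (htr w hw).differentiableAt.differentiableWithinAt)
      (fun w hw => (htr w hw).deriv) hz h0mem
    simp only at h
    rw [ha₂ s z hz, ha₂ s 0 h0mem, hd0, mul_zero, sub_zero, one_mul] at h
    have e1 : (-σ * κf z) ^ 2 = κf z ^ 2 := by rw [mul_pow, neg_sq, show σ ^ 2 = 1 by rw [sq, hσσ], one_mul]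
    have e2 : (-σ * κf 0) ^ 2 = κf 0 ^ 2 := by rw [mul_pow, neg_sq, show σ ^ 2 = 1 by rw [sq, hσσ], one_mul]
    rw [e1, e2] at h
    exact h
  /- STEP F: the two slope sub-cases. -/
  by_cases hμ00 : μ (-1) 0 = 0
  · /- `μ(−1,0) = 0`: `d′ ≡ 0`, `μ(−1,·) ≡ 0` on the window, no vertical shear ⇒ `U ≡ 0`. -/
    have hd'0 : deriv d 0 = 0 := by
      have h := hQ0 0 h0mem
      rw [hμ00, add_zero] at h
      exact pow_eq_zero_iff (two_ne_zero) |>.1 h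
    have hμ0 : ∀ z ∈ Ioo (-δ₂) δ₂, μ (-1) z = 0 := by
      intro z hz
      have h := hconst 0 z hz
      rw [hd'0, zero_mul] at h
      have hd' : deriv d z = 0 := by
        rcases mul_eq_zero.1 h with h1 | h1
        · rcases mul_eq_zero.1 h1 with h2 | h2
          · exact absurd h2 (hJ 0 z hz)
          · exact h2
        · exact absurd (pow_eq_zero_iff (two_ne_zero) |>.1 h1) (hκfpos z hz).ne'
      have h := hQ0 z hz
      rw [hd', zero_pow two_ne_zero, zero_add] at h
      exact h
    have hO : IsOpen {x : EuclideanSpace ℝ (Fin 3) | x 2 ∈ Ioo (-δ₂) δ₂} :=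
      isOpen_Ioo.preimage (EuclideanSpace.proj (𝕜 := ℝ) (2 : Fin 3)).continuous
    have hOne : ({x : EuclideanSpace ℝ (Fin 3) | x 2 ∈ Ioo (-δ₂) δ₂}).Nonempty := ⟨0, by simpa using h0mem⟩
    have hshear : ∀ y ∈ {x : EuclideanSpace ℝ (Fin 3) | x 2 ∈ Ioo (-δ₂) δ₂},
        fderiv ℝ (U (-1)) y (EuclideanSpace.single 2 1) 0 = 0 ∧ fderiv ℝ (U (-1)) y (EuclideanSpace.single 2 1) 1 = 0 := by
      intro y hy
      have h := fun b : Fin 3 => fun hb : b ≠ 2 => hslabU (-1) (by simp [hρ]) y (hwinρ _ hy) b hb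
      refine ⟨?_, ?_⟩
      · rw [h 0 (by decide), hμ0 _ hy, zero_mul]
      · rw [h 1 (by decide), hμ0 _ hy, zero_mul]
    have hzero := eq_zero_of_verticalShear_eq_zero_on_open hUrate hUcont hUmild hUdiv hm1 hO hOne hshear (-1) hm1 0
    exact hUne (by rw [hzero]; rfl)
  · /- `μ(−1,0) ≠ 0`: `d′(0) ≠ 0`; at a height `z₁` with `d(z₁)d′(z₁) ≠ 0` the curvature `k(s)` equals `k(0)` for every `s` ⇒ `Γ` is a line. -/
    have hd'0 : deriv d 0 ≠ 0 := by
      intro h0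
      have h := hQ0 0 h0mem
      rw [h0, zero_pow two_ne_zero, zero_add] at h
      exact hμ00 h
    -- `d′ ≠ 0` near `0` (continuity of `d′`)
    have hd1 : ContDiffOn ℝ ∞ (deriv d) (Ioo (-δ₂) δ₂) := hdI.deriv_of_isOpen isOpen_Ioo (m := ∞) (by simp)
    have hd'c : ContinuousAt (deriv d) 0 := (hd1.contDiffAt (isOpen_Ioo.mem_nhds h0mem)).continuousAt
    obtain ⟨ε, hε, hεd⟩ : ∃ ε > 0, ∀ z : ℝ, |z| < ε → deriv d z ≠ 0 := by
      have h1 : ∀ᶠ z in 𝓝 (0 : ℝ), deriv d z ≠ 0 := hd'c.eventually_ne hd'0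
      obtain ⟨ε, hε, h⟩ := Metric.eventually_nhds_iff.1 h1
      exact ⟨ε, hε, fun z hz => h (by simpa [Real.dist_eq] using hz)⟩
    set z₁ : ℝ := min ε δ₂ / 2 with hz₁
    have hz₁pos : 0 < z₁ := by rw [hz₁]; positivity
    have hz₁ε : z₁ < ε := by rw [hz₁]; linarith [min_le_left ε δ₂]
    have hz₁δ : z₁ < δ₂ := by rw [hz₁]; linarith [min_le_right ε δ₂]
    have hz₁mem : z₁ ∈ Ioo (-δ₂) δ₂ := ⟨by linarith, hz₁δ⟩
    have hd'z₁ : deriv d z₁ ≠ 0 := hεd z₁ (by rw [abs_of_pos hz₁pos]; exact hz₁ε)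
    -- `d(z₁) ≠ 0` by the mean value theorem
    have hdd : ∀ z ∈ Ioo (-δ₂) δ₂, HasDerivAt d (deriv d z) z := fun z hz =>
      ((hdi z (hwinδ z hz)).differentiableAt (by simp)).hasDerivAt
    have hdz₁ : d z₁ ≠ 0 := by
      intro h0
      obtain ⟨ξ, hξ, hslope⟩ := exists_hasDerivAt_eq_slope d (deriv d) hz₁pos
        (fun w hw => (hdd w ⟨by linarith [hw.1], lt_of_le_of_lt hw.2 hz₁δ⟩).continuousAt.continuousWithinAt)
        (fun w hw => hdd w ⟨by linarith [hw.1], lt_trans hw.2 hz₁δ⟩)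
      rw [h0, hd0, sub_zero, zero_div] at hslope
      exact hεd ξ (by rw [abs_of_pos hξ.1]; exact lt_trans hξ.2 hz₁ε) hslope
    -- constant curvature
    have hkconst : ∀ s, k s = k 0 := by
      intro s
      have h1 := hconst s z₁ hz₁mem
      have h2 := hconst 0 z₁ hz₁mem
      have h : (k s - k 0) * (d z₁ * deriv d z₁ * κf z₁ ^ 2) = 0 := by linear_combination h2 - h1
      rcases mul_eq_zero.1 h with h3 | h3
      · linarith
      · exfalso
        have : d z₁ * deriv d z₁ * κf z₁ ^ 2 ≠ 0 :=
          mul_ne_zero (mul_ne_zero hdz₁ hd'z₁) (pow_ne_zero 2 (hκfpos z₁ hz₁mem).ne')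
        exact this h3
    -- the proper limit branch of constant curvature is a line
    have hprop := (limitBranch_injective_proper hUrate hUcont hUmild hUdiv hUpol hUne hUhotbd hUpeak hUcrit hσ hσN hκ hΓc2 hΓ2 hΓunit hΓhot hν
      hΓcurv hρ hμ3 hevU).2.1
    exact hcurved (isLine_of_curvature_const_of_tendsto hΓc2 hΓ2 hΓunit hΓ0 hk hkconst hprop)

end Summit.NavierStokesRegularity.NavierStokesRegularity.Theorems.PoloidalWindowDoorLrcModEntireQ4SonicCurved
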